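import Mathlib.Analysis.SpecialFunctions.Pow.Deriv
import Mathlib.Analysis.SpecialFunctions.Log.Basic
import Mathlib.Analysis.SpecialFunctions.Exp
import Mathlib.MeasureTheory.Integral.IntervalIntegral.FundThmCalculus
import Mathlib.Algebra.Order.Field.GeomSum
import Mathlib.Analysis.Complex.ExponentialBounds
import HarnessLib

/-!
# Tools for Gallagher's Theorem 7 (Montgomery–Vaughan 1975, Lemma 4.3): the zero terms of the
explicit formula in short intervals, and the sum over zeros against a log-free density bound —
PROVED

P. X. Gallagher, *A large sieve density estimate near `σ = 1`*, Invent. Math. 11 (1970)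
329–339, §5 (proof of Theorem 7), as used in H. L. Montgomery, R. C. Vaughan, *The exceptional
set in Goldbach's problem*, Acta Arith. 27 (1975) 353–370, Lemma 4.3 [MontgomeryVaughanActa1975].
Two self-contained real/complex-analysis lemmas of that derivation, free of `L`-functions:

* `norm_cpow_sub_cpow_div_le` — the term of a zero `ρ = β + iγ` in
  `ψ(x, χ) − ψ(y, χ) = −∑_ρ (x^ρ − y^ρ)/ρ + …`: for `0 < y ≤ x`, `ρ ≠ 0`, `β ≤ 1`,
  **`|(x^ρ − y^ρ)/ρ| ≤ (x − y) y^{β−1}`** (`= |∫_y^x u^{ρ−1} du|`; cruder `norm_cpow_sub_cpow_div_le'`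
  with `x` in place of `x − y`); and `norm_cpow_div_eq`: `|x^ρ/ρ| = x^β/|ρ|`.
* `sum_rpow_sub_one_le_of_density` — **the sum over zeros against a log-free density bound**:
  if finitely many reals `βᵢ ≤ 1 − η` satisfy `#{i : βᵢ ≥ α} ≤ A B^{1−α}` for all `α ≤ 1 − η`
  (Gallagher's Theorem 6: `∑_{q≤T} ∑*_χ N(α, T, χ) ≪ T^{c(1−α)}`, `B = T^c`), then for `x ≥ B²`
  **`∑ᵢ x^{βᵢ−1} ≤ 5 A (B/x)^η`** — the saving `(B/x)^η = exp(−η log(x/B))`, which for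
  `η = c₁/log T`, `x = T^{C}` is Gallagher's `exp(−c log x/log T)`. (Slice `βᵢ` according to
  `k = ⌊(1 − η − βᵢ) log x⌋`: the `k`-th slice has `≤ A B^{η + (k+1)/log x}` elements, each with
  `x^{βᵢ−1} ≤ x^{−η} e^{−k}`, and `B^{1/log x} ≤ e^{1/2}`, so the slices sum to
  `≤ A (B/x)^η e^{1/2}/(1 − e^{−1/2}) < 5 A (B/x)^η`.)
  Weighted form (multiplicities): `sum_mul_rpow_sub_one_le_of_density`.

No named facts; nothing here depends on the rest of the tree.

## References

* P. X. Gallagher, Invent. Math. 11 (1970) 329–339, §5 [Gallagher1970].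
* H. L. Montgomery, R. C. Vaughan, Acta Arith. 27 (1975) 353–370, §4 Lemma 4.3
  [MontgomeryVaughanActa1975].
-/

noncomputable section

open Real Finset MeasureTheory intervalIntegral

namespace Literature.NumberTheory.Sieve.MontgomeryVaughan1975

/-! ### The zero terms `(x^ρ − y^ρ)/ρ` -/

/-- `|x^ρ/ρ| = x^β/|ρ|` for `x > 0`. [folklore] -/
theorem norm_cpow_div_eq {x : ℝ} (hx : 0 < x) (ρ : ℂ) :
    ‖(x : ℂ) ^ ρ / ρ‖ = x ^ ρ.re / ‖ρ‖ := by
  rw [norm_div, Complex.norm_cpow_eq_rpow_re_of_pos hx]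

/-- **The zero term in a short interval**: for `0 < y ≤ x`, `ρ ≠ 0` and `Re ρ ≤ 1`,
`|(x^ρ − y^ρ)/ρ| ≤ (x − y) y^{Re ρ − 1}` (Gallagher 1970, §5: "`|((x+h)^ρ − x^ρ)/ρ| ≤ h x^{β−1}`";
`(x^ρ − y^ρ)/ρ = ∫_y^x u^{ρ−1} du` and `|u^{ρ−1}| = u^{β−1} ≤ y^{β−1}` on `[y, x]`).
[cite: Gallagher1970, §5] -/
theorem norm_cpow_sub_cpow_div_le {x y : ℝ} (hy : 0 < y) (hyx : y ≤ x) {ρ : ℂ} (hρ : ρ ≠ 0)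
    (hre : ρ.re ≤ 1) :
    ‖((x : ℂ) ^ ρ - (y : ℂ) ^ ρ) / ρ‖ ≤ (x - y) * y ^ (ρ.re - 1) := by
  -- `u ↦ u^ρ/ρ` is a primitive of `u ↦ u^{ρ−1}` on `u > 0`
  have hderiv : ∀ u ∈ Set.uIcc y x, HasDerivAt (fun v : ℝ => (v : ℂ) ^ ρ / ρ)
      ((u : ℂ) ^ (ρ - 1)) u := by
    intro u hu
    rw [Set.uIcc_of_le hyx] at hu
    have hu0 : u ≠ 0 := (lt_of_lt_of_le hy hu.1).ne'
    have h := hasDerivAt_ofReal_cpow_const' hu0 (r := ρ - 1) (by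
      intro h; apply hρ; linear_combination h)
    simp only [sub_add_cancel] at h
    exact h
  have hcont : ContinuousOn (fun u : ℝ => (u : ℂ) ^ (ρ - 1)) (Set.uIcc y x) := by
    intro u hu
    rw [Set.uIcc_of_le hyx] at hu
    have hu0 : u ≠ 0 := (lt_of_lt_of_le hy hu.1).ne'
    exact (Complex.continuousAt_ofReal_cpow_const u (ρ - 1) (Or.inr hu0)).continuousWithinAt
  have hint : IntervalIntegrable (fun u : ℝ => (u : ℂ) ^ (ρ - 1)) volume y x :=
    hcont.intervalIntegrable
  have hftc := integral_eq_sub_of_hasDerivAt hderiv hint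
  -- so `(x^ρ − y^ρ)/ρ = ∫_y^x u^{ρ−1} du`
  have hid : ((x : ℂ) ^ ρ - (y : ℂ) ^ ρ) / ρ = ∫ u in y..x, (u : ℂ) ^ (ρ - 1) := by
    rw [hftc, sub_div]
  rw [hid]
  -- and `|u^{ρ−1}| = u^{β−1} ≤ y^{β−1}` on `(y, x]`
  have hbound : ∀ u ∈ Set.uIoc y x, ‖(u : ℂ) ^ (ρ - 1)‖ ≤ y ^ (ρ.re - 1) := by
    intro u hu
    rw [Set.uIoc_of_le hyx] at hu
    have hu0 : 0 < u := lt_trans hy hu.1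
    rw [Complex.norm_cpow_eq_rpow_re_of_pos hu0, Complex.sub_re, Complex.one_re]
    exact Real.rpow_le_rpow_of_nonpos hy hu.1.le (by linarith)
  calc ‖∫ u in y..x, (u : ℂ) ^ (ρ - 1)‖ ≤ y ^ (ρ.re - 1) * |x - y| :=
        norm_integral_le_of_norm_le_const hbound
    _ = (x - y) * y ^ (ρ.re - 1) := by rw [abs_of_nonneg (by linarith), mul_comm]

/-- The same with the cruder factor `x − y ≤ x`: `|(x^ρ − y^ρ)/ρ| ≤ x y^{Re ρ − 1}`. [folklore] -/
theorem norm_cpow_sub_cpow_div_le' {x y : ℝ} (hy : 0 < y) (hyx : y ≤ x) {ρ : ℂ} (hρ : ρ ≠ 0)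
    (hre : ρ.re ≤ 1) :
    ‖((x : ℂ) ^ ρ - (y : ℂ) ^ ρ) / ρ‖ ≤ x * y ^ (ρ.re - 1) :=
  (norm_cpow_sub_cpow_div_le hy hyx hρ hre).trans
    (mul_le_mul_of_nonneg_right (by linarith) (Real.rpow_nonneg hy.le _))

/-! ### The sum over zeros against a log-free density bound -/

/-- Numerical constant: `e^{1/2}/(1 − e^{−1/2}) ≤ 5`. [folklore] -/
theorem exp_half_div_le_five : Real.exp (1 / 2) / (1 - Real.exp (-(1 / 2))) ≤ 5 := by
  set u : ℝ := Real.exp (1 / 2) with hu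
  have hu0 : 0 < u := Real.exp_pos _
  have husq : u * u = Real.exp 1 := by
    rw [hu, ← Real.exp_add]; norm_num
  have he1 := Real.exp_one_lt_d9
  have he2 := Real.exp_one_gt_d9
  have hu_lt : u < 1.65 := by nlinarith
  have hu_gt : 1.64 < u := by nlinarith
  have hinv : Real.exp (-(1 / 2)) = u⁻¹ := by rw [hu, Real.exp_neg]
  have hden : 0 < 1 - u⁻¹ := by
    rw [sub_pos, inv_lt_one_iff₀]; right; linarith
  rw [hinv, div_le_iff₀ hden]
  -- `u ≤ 5 (1 − 1/u)`, i.e. `u² − 5u + 5 ≤ 0`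
  have h1 : u * (1 - u⁻¹) = u - 1 := by field_simp
  nlinarith [mul_le_mul_of_nonneg_left hden.le hu0.le, h1]

/-- A finite geometric sum over any finite set of exponents: `∑_{k ∈ t} r^k ≤ 1/(1 − r)` for
`0 ≤ r < 1`. [folklore] -/
theorem sum_pow_le_of_lt_one (t : Finset ℕ) {r : ℝ} (hr0 : 0 ≤ r) (hr1 : r < 1) :
    ∑ k ∈ t, r ^ k ≤ 1 / (1 - r) := by
  set K : ℕ := t.sup id + 1 with hK
  have hsub : t ⊆ Finset.range K := by
    intro k hk
    rw [Finset.mem_range, hK]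
    have : k ≤ t.sup id := Finset.le_sup (f := id) hk
    omega
  calc ∑ k ∈ t, r ^ k ≤ ∑ k ∈ Finset.range K, r ^ k :=
        Finset.sum_le_sum_of_subset_of_nonneg hsub fun k _ _ => pow_nonneg hr0 k
    _ = ∑ k ∈ Finset.Ico 0 K, r ^ k := by rw [Finset.range_eq_Ico]
    _ ≤ r ^ 0 / (1 - r) := geom_sum_Ico_le_of_lt_one hr0 hr1
    _ = 1 / (1 - r) := by rw [pow_zero]

/-- **The sum over zeros against a log-free density bound** (the heart of the derivation of
Gallagher's Theorem 7 from his Theorem 6, Gallagher 1970 §5; M–V 1975 Lemma 4.3): let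
`βᵢ ≤ 1 − η` (`i ∈ s`, a finite family — the real parts of the zeros off the zero-free region) with
the density bound `#{i ∈ s : α ≤ βᵢ} ≤ A B^{1−α}` for every `α ≤ 1 − η` (`A ≥ 0`, `B ≥ 1`). Then for
`x ≥ B²` (`x > 1`), `∑_{i ∈ s} x^{βᵢ − 1} ≤ 5 A (B/x)^η`.
[cite: Gallagher1970, §5] [cite: MontgomeryVaughanActa1975, §4 Lemma 4.3] -/
theorem sum_rpow_sub_one_le_of_density {ι : Type*} (s : Finset ι) (β : ι → ℝ) {x B A η : ℝ}
    (hx : 1 < x) (hB : 1 ≤ B) (hBx : B ^ 2 ≤ x) (hA : 0 ≤ A)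
    (hβ : ∀ i ∈ s, β i ≤ 1 - η)
    (hdens : ∀ α : ℝ, α ≤ 1 - η →
      ((s.filter (fun i => α ≤ β i)).card : ℝ) ≤ A * B ^ (1 - α)) :
    ∑ i ∈ s, x ^ (β i - 1) ≤ 5 * A * (B / x) ^ η := by
  classical
  have hx0 : 0 < x := by linarith
  have hB0 : 0 < B := by linarith
  set L : ℝ := Real.log x with hL
  have hL0 : 0 < L := Real.log_pos hx
  -- the slice index `k i = ⌊(1 − η − βᵢ) L⌋`
  set k : ι → ℕ := fun i => ⌊(1 - η - β i) * L⌋₊ with hk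
  have hkle : ∀ i ∈ s, (k i : ℝ) ≤ (1 - η - β i) * L := fun i hi =>
    Nat.floor_le (mul_nonneg (by linarith [hβ i hi]) hL0.le)
  have hklt : ∀ i, (1 - η - β i) * L < k i + 1 := fun i => Nat.lt_floor_add_one _
  -- each term of the `j`-th slice is `≤ x^{−η} e^{−j}`
  have hterm : ∀ i ∈ s, x ^ (β i - 1) ≤ x ^ (-η) * Real.exp (-(k i : ℝ)) := by
    intro i hi
    have h1 : β i - 1 ≤ -η - k i / L := by
      have := hkle i hi
      have h2 : (k i : ℝ) / L ≤ 1 - η - β i := by rwa [div_le_iff₀ hL0]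
      linarith
    calc x ^ (β i - 1) ≤ x ^ (-η - k i / L) := Real.rpow_le_rpow_of_exponent_le hx.le h1
      _ = x ^ (-η) * x ^ (-(k i / L)) := by rw [sub_eq_add_neg, Real.rpow_add hx0]
      _ = x ^ (-η) * Real.exp (-(k i : ℝ)) := by
          congr 1
          rw [Real.rpow_def_of_pos hx0, ← hL]
          congr 1
          field_simp
  -- the `j`-th slice lies in `{i : 1 − η − (j+1)/L ≤ βᵢ}`, of size `≤ A B^{η + (j+1)/L}`
  have hslice : ∀ j : ℕ, (((s.filter fun i => k i = j).card : ℕ) : ℝ) ≤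
      A * B ^ (η + ((j : ℝ) + 1) / L) := by
    intro j
    have hsub : (s.filter fun i => k i = j) ⊆ s.filter fun i => 1 - η - ((j : ℝ) + 1) / L ≤ β i := by
      intro i hi
      rw [Finset.mem_filter] at hi ⊢
      refine ⟨hi.1, ?_⟩
      have h1 := hklt i
      rw [hi.2] at h1
      have h2 : 1 - η - β i < ((j : ℝ) + 1) / L := by rw [lt_div_iff₀ hL0]; exact h1
      linarith
    have hα : 1 - η - ((j : ℝ) + 1) / L ≤ 1 - η := by
      have : 0 ≤ ((j : ℝ) + 1) / L := by positivity
      linarith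
    calc (((s.filter fun i => k i = j).card : ℕ) : ℝ)
        ≤ ((s.filter fun i => 1 - η - ((j : ℝ) + 1) / L ≤ β i).card : ℝ) := by
          exact_mod_cast Finset.card_le_card hsub
      _ ≤ A * B ^ (1 - (1 - η - ((j : ℝ) + 1) / L)) := hdens _ hα
      _ = A * B ^ (η + ((j : ℝ) + 1) / L) := by ring_nf
  -- `B^{1/L} ≤ e^{1/2}`, ratio `r = B^{1/L}/e ≤ e^{−1/2} < 1`
  set b : ℝ := B ^ (1 / L) with hb
  have hb0 : 0 < b := Real.rpow_pos_of_pos hB0 _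
  have hb1 : 1 ≤ b := Real.one_le_rpow hB (by positivity)
  have hble : b ≤ Real.exp (1 / 2) := by
    rw [hb, Real.rpow_def_of_pos hB0, Real.exp_le_exp]
    have hlogB : Real.log B ≤ L / 2 := by
      have h1 : Real.log (B ^ 2) ≤ Real.log x := Real.log_le_log (by positivity) hBx
      rw [Real.log_pow] at h1
      push_cast at h1
      rw [hL]; linarith
    calc Real.log B * (1 / L) = Real.log B / L := by ring
      _ ≤ (L / 2) / L := div_le_div_of_nonneg_right hlogB hL0.le
      _ = 1 / 2 := by field_simp
  set r : ℝ := b * Real.exp (-1) with hr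
  have hr0 : 0 ≤ r := by positivity
  have hrle : r ≤ Real.exp (-(1 / 2)) := by
    calc r ≤ Real.exp (1 / 2) * Real.exp (-1) :=
          mul_le_mul_of_nonneg_right hble (Real.exp_pos _).le
      _ = Real.exp (-(1 / 2)) := by rw [← Real.exp_add]; norm_num
  have hr1 : r < 1 := lt_of_le_of_lt hrle (by rw [Real.exp_lt_one_iff]; norm_num)
  -- the slices: `B^{η + (j+1)/L} e^{−j} = B^η b r^j`
  have hpow : ∀ j : ℕ, B ^ (η + ((j : ℝ) + 1) / L) * Real.exp (-(j : ℝ)) = B ^ η * b * r ^ j := by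
    intro j
    rw [Real.rpow_add hB0, show ((j : ℝ) + 1) / L = (1 / L) * ((j : ℝ) + 1) by ring,
      Real.rpow_mul hB0.le, ← hb, hr, mul_pow, ← Real.exp_nat_mul, Real.rpow_add_one hb0.ne',
      Real.rpow_natCast]
    ring_nf
  -- sum slice by slice
  set t : Finset ℕ := s.image k with ht
  have hmaps : ∀ i ∈ s, k i ∈ t := fun i hi => Finset.mem_image_of_mem k hi
  calc ∑ i ∈ s, x ^ (β i - 1)
      = ∑ j ∈ t, ∑ i ∈ s with k i = j, x ^ (β i - 1) :=
        (Finset.sum_fiberwise_of_maps_to hmaps _).symm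
    _ ≤ ∑ j ∈ t, ∑ i ∈ s with k i = j, x ^ (-η) * Real.exp (-(j : ℝ)) := by
        refine Finset.sum_le_sum fun j _ => Finset.sum_le_sum fun i hi => ?_
        rw [Finset.mem_filter] at hi
        have := hterm i hi.1
        rwa [hi.2] at this
    _ = ∑ j ∈ t, ((s.filter fun i => k i = j).card : ℝ) * (x ^ (-η) * Real.exp (-(j : ℝ))) := by
        refine Finset.sum_congr rfl fun j _ => ?_
        rw [Finset.sum_const, nsmul_eq_mul]
    _ ≤ ∑ j ∈ t, A * B ^ (η + ((j : ℝ) + 1) / L) * (x ^ (-η) * Real.exp (-(j : ℝ))) := by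
        refine Finset.sum_le_sum fun j _ => ?_
        exact mul_le_mul_of_nonneg_right (hslice j) (by positivity)
    _ = A * (B ^ η * x ^ (-η)) * b * ∑ j ∈ t, r ^ j := by
        rw [Finset.mul_sum]
        refine Finset.sum_congr rfl fun j _ => ?_
        have := hpow j
        calc A * B ^ (η + ((j : ℝ) + 1) / L) * (x ^ (-η) * Real.exp (-(j : ℝ)))
            = A * x ^ (-η) * (B ^ (η + ((j : ℝ) + 1) / L) * Real.exp (-(j : ℝ))) := by ring
          _ = A * x ^ (-η) * (B ^ η * b * r ^ j) := by rw [this]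
          _ = A * (B ^ η * x ^ (-η)) * b * r ^ j := by ring
    _ ≤ A * (B ^ η * x ^ (-η)) * b * (1 / (1 - r)) := by
        apply mul_le_mul_of_nonneg_left (sum_pow_le_of_lt_one t hr0 hr1)
        positivity
    _ ≤ A * (B ^ η * x ^ (-η)) * (Real.exp (1 / 2) / (1 - Real.exp (-(1 / 2)))) := by
        rw [mul_assoc (A * (B ^ η * x ^ (-η)))]
        apply mul_le_mul_of_nonneg_left _ (by positivity)
        have hden : 0 < 1 - Real.exp (-(1 / 2)) := by
          rw [sub_pos, Real.exp_lt_one_iff]; norm_num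
        calc b * (1 / (1 - r)) ≤ Real.exp (1 / 2) * (1 / (1 - Real.exp (-(1 / 2)))) := by
              apply mul_le_mul hble _ (by positivity) (Real.exp_pos _).le
              apply one_div_le_one_div_of_le hden
              linarith
          _ = Real.exp (1 / 2) / (1 - Real.exp (-(1 / 2))) := by ring
    _ ≤ A * (B ^ η * x ^ (-η)) * 5 :=
        mul_le_mul_of_nonneg_left exp_half_div_le_five (by positivity)
    _ = 5 * A * (B / x) ^ η := by
        rw [Real.div_rpow hB0.le hx0.le, Real.rpow_neg hx0.le, div_eq_mul_inv]
        ring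

/-- **Weighted form** of `sum_rpow_sub_one_le_of_density` (zeros counted with multiplicity
`wᵢ ≥ 0`): if `βᵢ ≤ 1 − η` and `∑_{i : α ≤ βᵢ} wᵢ ≤ A B^{1−α}` for every `α ≤ 1 − η`, then for
`x ≥ B²`, `∑ᵢ wᵢ x^{βᵢ − 1} ≤ 5 A (B/x)^η`. [cite: Gallagher1970, §5] -/
theorem sum_mul_rpow_sub_one_le_of_density {ι : Type*} (s : Finset ι) (β w : ι → ℝ)
    {x B A η : ℝ} (hx : 1 < x) (hB : 1 ≤ B) (hBx : B ^ 2 ≤ x) (hA : 0 ≤ A)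
    (hw : ∀ i ∈ s, 0 ≤ w i) (hβ : ∀ i ∈ s, β i ≤ 1 - η)
    (hdens : ∀ α : ℝ, α ≤ 1 - η → ∑ i ∈ s with α ≤ β i, w i ≤ A * B ^ (1 - α)) :
    ∑ i ∈ s, w i * x ^ (β i - 1) ≤ 5 * A * (B / x) ^ η := by
  classical
  have hx0 : 0 < x := by linarith
  have hB0 : 0 < B := by linarith
  set L : ℝ := Real.log x with hL
  have hL0 : 0 < L := Real.log_pos hx
  set k : ι → ℕ := fun i => ⌊(1 - η - β i) * L⌋₊ with hk
  have hkle : ∀ i ∈ s, (k i : ℝ) ≤ (1 - η - β i) * L := fun i hi =>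
    Nat.floor_le (mul_nonneg (by linarith [hβ i hi]) hL0.le)
  have hklt : ∀ i, (1 - η - β i) * L < k i + 1 := fun i => Nat.lt_floor_add_one _
  have hterm : ∀ i ∈ s, x ^ (β i - 1) ≤ x ^ (-η) * Real.exp (-(k i : ℝ)) := by
    intro i hi
    have h1 : β i - 1 ≤ -η - k i / L := by
      have := hkle i hi
      have h2 : (k i : ℝ) / L ≤ 1 - η - β i := by rwa [div_le_iff₀ hL0]
      linarith
    calc x ^ (β i - 1) ≤ x ^ (-η - k i / L) := Real.rpow_le_rpow_of_exponent_le hx.le h1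
      _ = x ^ (-η) * x ^ (-(k i / L)) := by rw [sub_eq_add_neg, Real.rpow_add hx0]
      _ = x ^ (-η) * Real.exp (-(k i : ℝ)) := by
          congr 1
          rw [Real.rpow_def_of_pos hx0, ← hL]
          congr 1
          field_simp
  -- the weight of the `j`-th slice
  have hslice : ∀ j : ℕ, ∑ i ∈ s with k i = j, w i ≤ A * B ^ (η + ((j : ℝ) + 1) / L) := by
    intro j
    have hsub : (s.filter fun i => k i = j) ⊆ s.filter fun i => 1 - η - ((j : ℝ) + 1) / L ≤ β i := by
      intro i hi
      rw [Finset.mem_filter] at hi ⊢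
      refine ⟨hi.1, ?_⟩
      have h1 := hklt i
      rw [hi.2] at h1
      have h2 : 1 - η - β i < ((j : ℝ) + 1) / L := by rw [lt_div_iff₀ hL0]; exact h1
      linarith
    have hα : 1 - η - ((j : ℝ) + 1) / L ≤ 1 - η := by
      have : 0 ≤ ((j : ℝ) + 1) / L := by positivity
      linarith
    calc ∑ i ∈ s with k i = j, w i ≤ ∑ i ∈ s with 1 - η - ((j : ℝ) + 1) / L ≤ β i, w i :=
          Finset.sum_le_sum_of_subset_of_nonneg hsub fun i hi _ => hw i (Finset.mem_filter.mp hi).1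
      _ ≤ A * B ^ (1 - (1 - η - ((j : ℝ) + 1) / L)) := hdens _ hα
      _ = A * B ^ (η + ((j : ℝ) + 1) / L) := by ring_nf
  set b : ℝ := B ^ (1 / L) with hb
  have hb0 : 0 < b := Real.rpow_pos_of_pos hB0 _
  have hble : b ≤ Real.exp (1 / 2) := by
    rw [hb, Real.rpow_def_of_pos hB0, Real.exp_le_exp]
    have hlogB : Real.log B ≤ L / 2 := by
      have h1 : Real.log (B ^ 2) ≤ Real.log x := Real.log_le_log (by positivity) hBx
      rw [Real.log_pow] at h1
      push_cast at h1
      rw [hL]; linarith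
    calc Real.log B * (1 / L) = Real.log B / L := by ring
      _ ≤ (L / 2) / L := div_le_div_of_nonneg_right hlogB hL0.le
      _ = 1 / 2 := by field_simp
  set r : ℝ := b * Real.exp (-1) with hr
  have hr0 : 0 ≤ r := by positivity
  have hrle : r ≤ Real.exp (-(1 / 2)) := by
    calc r ≤ Real.exp (1 / 2) * Real.exp (-1) :=
          mul_le_mul_of_nonneg_right hble (Real.exp_pos _).le
      _ = Real.exp (-(1 / 2)) := by rw [← Real.exp_add]; norm_num
  have hr1 : r < 1 := lt_of_le_of_lt hrle (by rw [Real.exp_lt_one_iff]; norm_num)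
  have hpow : ∀ j : ℕ, B ^ (η + ((j : ℝ) + 1) / L) * Real.exp (-(j : ℝ)) = B ^ η * b * r ^ j := by
    intro j
    rw [Real.rpow_add hB0, show ((j : ℝ) + 1) / L = (1 / L) * ((j : ℝ) + 1) by ring,
      Real.rpow_mul hB0.le, ← hb, hr, mul_pow, ← Real.exp_nat_mul, Real.rpow_add_one hb0.ne',
      Real.rpow_natCast]
    ring_nf
  set t : Finset ℕ := s.image k with ht
  have hmaps : ∀ i ∈ s, k i ∈ t := fun i hi => Finset.mem_image_of_mem k hi
  calc ∑ i ∈ s, w i * x ^ (β i - 1)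
      = ∑ j ∈ t, ∑ i ∈ s with k i = j, w i * x ^ (β i - 1) :=
        (Finset.sum_fiberwise_of_maps_to hmaps _).symm
    _ ≤ ∑ j ∈ t, ∑ i ∈ s with k i = j, w i * (x ^ (-η) * Real.exp (-(j : ℝ))) := by
        refine Finset.sum_le_sum fun j _ => Finset.sum_le_sum fun i hi => ?_
        rw [Finset.mem_filter] at hi
        have := hterm i hi.1
        rw [hi.2] at this
        exact mul_le_mul_of_nonneg_left this (hw i hi.1)
    _ = ∑ j ∈ t, (∑ i ∈ s with k i = j, w i) * (x ^ (-η) * Real.exp (-(j : ℝ))) := by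
        refine Finset.sum_congr rfl fun j _ => ?_
        rw [Finset.sum_mul]
    _ ≤ ∑ j ∈ t, A * B ^ (η + ((j : ℝ) + 1) / L) * (x ^ (-η) * Real.exp (-(j : ℝ))) := by
        refine Finset.sum_le_sum fun j _ => ?_
        exact mul_le_mul_of_nonneg_right (hslice j) (by positivity)
    _ = A * (B ^ η * x ^ (-η)) * b * ∑ j ∈ t, r ^ j := by
        rw [Finset.mul_sum]
        refine Finset.sum_congr rfl fun j _ => ?_
        have := hpow j
        calc A * B ^ (η + ((j : ℝ) + 1) / L) * (x ^ (-η) * Real.exp (-(j : ℝ)))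
            = A * x ^ (-η) * (B ^ (η + ((j : ℝ) + 1) / L) * Real.exp (-(j : ℝ))) := by ring
          _ = A * x ^ (-η) * (B ^ η * b * r ^ j) := by rw [this]
          _ = A * (B ^ η * x ^ (-η)) * b * r ^ j := by ring
    _ ≤ A * (B ^ η * x ^ (-η)) * b * (1 / (1 - r)) := by
        apply mul_le_mul_of_nonneg_left (sum_pow_le_of_lt_one t hr0 hr1)
        positivity
    _ ≤ A * (B ^ η * x ^ (-η)) * (Real.exp (1 / 2) / (1 - Real.exp (-(1 / 2)))) := by
        rw [mul_assoc (A * (B ^ η * x ^ (-η)))]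
        apply mul_le_mul_of_nonneg_left _ (by positivity)
        have hden : 0 < 1 - Real.exp (-(1 / 2)) := by
          rw [sub_pos, Real.exp_lt_one_iff]; norm_num
        calc b * (1 / (1 - r)) ≤ Real.exp (1 / 2) * (1 / (1 - Real.exp (-(1 / 2)))) := by
              apply mul_le_mul hble _ (by positivity) (Real.exp_pos _).le
              apply one_div_le_one_div_of_le hden
              linarith
          _ = Real.exp (1 / 2) / (1 - Real.exp (-(1 / 2))) := by ring
    _ ≤ A * (B ^ η * x ^ (-η)) * 5 :=
        mul_le_mul_of_nonneg_left exp_half_div_le_five (by positivity)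
    _ = 5 * A * (B / x) ^ η := by
        rw [Real.div_rpow hB0.le hx0.le, Real.rpow_neg hx0.le, div_eq_mul_inv]
        ring

end Literature.NumberTheory.Sieve.MontgomeryVaughan1975
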